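import Summits.Ventures.YMGap.FlowData.RectTubeReweightedKernel
import HarnessLib

/-!
# Venture YMGap, track Y3 FLOW-DATA — the tube operator with SEPARATE temporal / spatial couplings on a rectangular cross-section
# and the derivative-free SECANT SANDWICH in the spatial (magnetic) coupling:
# `(J_M' − J_M)·⟨mag⟩_{Ω} ≤ log ‖T_{J_E,J_M'}‖ − log ‖T_{J_E,J_M}‖ ≤ (J_M' − J_M)·⟨mag⟩_{Ω'}` (one definition + theorems)

HONEST FRAMING: venture file of the cell `pub-ymgap` (QuantumFields programme), track Y3 (FLOW-DATA).  The FLOW-TABLE's plaquette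
rows on rectangular tubes (`2×3`: `P_t`, `P_s` by the SECANT-CONVEX method — chords of `ln λ̂₀` in the kinetic / plaquette coupling)
have no typed object; the cubic anisotropic operator is `TubeTransferAnisotropic.lean`.  Here: the rectangular two-coupling operator
`rectTubeTransferOperatorAniso ρ J_E J_M Ls` (kernel = the tree's two-coupling kernel `rectSliceKernel ρ J_E J_M`) and, from the
Gibbs–Bogoliubov sandwich of `RectTubeReweightedKernel.lean` (changing `J_M` at fixed `J_E` IS a reweighting `e^{g} K e^{g}`,
`g = (J_M' − J_M) mag/2`), the DERIVATIVE-FREE statement behind the magnetic secant leg: for `J_E ≥ 0`, `J_M ≤ J_M'` and unit vacua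
`Ω`, `Ω'` of `T_{J_E,J_M}`, `T_{J_E,J_M'}`,

  `(J_M' − J_M) ∫ mag Ω² ≤ log ‖T_{J_E,J_M'}‖ − log ‖T_{J_E,J_M}‖ ≤ (J_M' − J_M) ∫ mag Ω'²`

— every magnetic chord slope lies between the vacuum plaquette sums at its two ends (convexity + Hellmann–Feynman without
derivatives).  Finite spatial torus; `‖T‖ = λ₀` is the vacuum eigenvalue, not a gap; no number, no row; nothing about `L → ∞`,
the continuum or a mass gap.  The temporal (kinetic) leg is NOT a reweighting and is not treated here.

* `rectTubeTransferOperatorAniso` (the ONE definition), `_ae_eq`, `_self` (`T_{J,J} = rectTubeTransferOperator ρ J Ls`), self-adjoint,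
  compact, positivity improving, `‖·‖ > 0`, `exists_rectAnisoVacuum` (Jentzsch);
* `rectTubeTransferOperatorAniso_ae_eq_reweighted` (`K_{J_E,J_M'} = e^{g} K_{J_E,J_M} e^{g}`), `inner_rectTubeTransferOperatorAniso_self_nonneg`
  (Lüscher positivity for `J_E ≥ 0`, ANY real `J_M`, transported from the isotropic operator by reweighting);
* **`rectAniso_log_norm_sub_ge`**, **`rectAniso_log_norm_sub_le`** — the sandwich; the cell's `SU(2)` reading
  **`su2_rectAniso_secant_ge`** / **`su2_rectAniso_secant_le`** (`J_E = β_t/2`, `J_M = β_s/2`; `(h/2)·mag = h·Σ_p ½Tr U_p`):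
  `h·∫(Σ_p ½·Re tr U_p)Ω² ≤ ln λ₀(β_t, β_s + h) − ln λ₀(β_t, β_s) ≤ h·∫(Σ_p ½·Re tr U_p)Ω_h²` for `h ≥ 0`.

References: M. Reed, B. Simon IV (1978) §XIII.12 [cite: ReedSimonIV1978, §XIII.12]; M. Lüscher, Commun. Math. Phys. 54 (1977) 283
[cite: Luscher1977]; I. Montvay, G. Münster (1994) §3.2.6 [cite: MontvayMunster1994, §3.2.6].
-/

noncomputable section

open scoped BigOperators ENNReal RealInnerProductSpace
open MeasureTheory Filter Function
open Literature.MathematicalPhysics.QuantumFieldTheory Literature.Analysis.OperatorTheory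
open Literature.MathematicalPhysics.QuantumLattice (RectTorusSite fundamentalRep continuous_fundamentalRep
  fundamentalRep_mem_unitaryGroup)

namespace Summit.Ventures.YMGap.FlowData

section Operator

variable {G : Type*} [Group G] [TopologicalSpace G] [IsTopologicalGroup G] [CompactSpace G]
  [MeasurableSpace G] [BorelSpace G] {n k : ℕ} (ρ : G →* Matrix (Fin n) (Fin n) ℂ) (JE JM : ℝ) (Ls : Fin k → ℕ)
  [∀ i, NeZero (Ls i)]

/-- **The two-coupling tube operator on a rectangular cross-section** `T_{J_E,J_M}`: the bounded operator on `L²(rectSliceMeasure)`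
with kernel `rectSliceKernel ρ J_E J_M` (temporal coupling `J_E`, spatial coupling `J_M`); junk `0` unless the kernel is jointly
strongly measurable and bounded (automatic for continuous `ρ`, second-countable `G`). [cite: MontvayMunster1994, §3.2.6] -/
def rectTubeTransferOperatorAniso :
    Lp ℝ 2 (rectSliceMeasure G Ls) →L[ℝ] Lp ℝ 2 (rectSliceMeasure G Ls) := by
  classical
  exact if h : StronglyMeasurable (uncurry (rectSliceKernel (Ls := Ls) ρ JE JM)) ∧
      ∃ C : ℝ, ∀ a b : RectSlice Ls G, ‖rectSliceKernel ρ JE JM a b‖ ≤ C then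
    Classical.choose (exists_kernelOp (μ := rectSliceMeasure G Ls) h.1 h.2.choose_spec)
  else 0

/-- **Changing the spatial coupling is a reweighting**: `K_{J_E,J_M'}(a,b) = e^{g(a)} K_{J_E,J_M}(a,b) e^{g(b)}` with
`g = (J_M' − J_M)·mag/2`. [folklore] -/
theorem rectSliceKernel_mag_reweight (JM' : ℝ) (a b : RectSlice Ls G) :
    rectSliceKernel (Ls := Ls) ρ JE JM' a b = Real.exp ((JM' - JM) / 2 * rectMagSum ρ a) *
      rectSliceKernel (Ls := Ls) ρ JE JM a b * Real.exp ((JM' - JM) / 2 * rectMagSum ρ b) := by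
  have h : ∀ c : RectSlice Ls G, Real.exp (JM' / 2 * rectMagSum (Ls := Ls) ρ c) =
      Real.exp ((JM' - JM) / 2 * rectMagSum (Ls := Ls) ρ c) * Real.exp (JM / 2 * rectMagSum (Ls := Ls) ρ c) := by
    intro c; rw [← Real.exp_add]; congr 1; ring
  unfold rectSliceKernel
  rw [h, h]; ring

variable {ρ JE JM Ls} [SecondCountableTopology G]

/-- The kernel formula `(T_{J_E,J_M} φ)(a) = ∫ K_{J_E,J_M}(a,b) φ(b) db` a.e. (continuous `ρ`). [folklore] -/
theorem rectTubeTransferOperatorAniso_ae_eq (hρ : Continuous ρ) (φ : Lp ℝ 2 (rectSliceMeasure G Ls)) :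
    (rectTubeTransferOperatorAniso ρ JE JM Ls φ : RectSlice Ls G → ℝ) =ᵐ[rectSliceMeasure G Ls]
      fun a => ∫ b, rectSliceKernel ρ JE JM a b * φ b ∂(rectSliceMeasure G Ls) := by
  classical
  have h : StronglyMeasurable (uncurry (rectSliceKernel (Ls := Ls) ρ JE JM)) ∧
      ∃ C : ℝ, ∀ a b : RectSlice Ls G, ‖rectSliceKernel ρ JE JM a b‖ ≤ C :=
    ⟨stronglyMeasurable_uncurry_rectSliceKernel ρ hρ JE JM, exists_rectSliceKernel_le ρ hρ JE JM⟩
  unfold rectTubeTransferOperatorAniso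
  rw [dif_pos h]
  exact Classical.choose_spec (exists_kernelOp (μ := rectSliceMeasure G Ls) h.1 h.2.choose_spec) φ

/-- **`T_{J,J} = rectTubeTransferOperator ρ J Ls`** (the diagonal is the tree's isotropic operator). [folklore] -/
theorem rectTubeTransferOperatorAniso_self (hρ : Continuous ρ) (J : ℝ) :
    rectTubeTransferOperatorAniso ρ J J Ls = rectTubeTransferOperator ρ J Ls :=
  ContinuousLinearMap.ext fun φ => Lp.ext
    ((rectTubeTransferOperatorAniso_ae_eq hρ φ).trans (rectTubeTransferOperator_ae_eq J Ls hρ φ).symm)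

/-- `T_{J_E,J_M}` is self-adjoint (unitary `ρ`). [folklore] -/
theorem isSelfAdjoint_rectTubeTransferOperatorAniso (hρ : Continuous ρ) (hρu : ∀ g, ρ g ∈ Matrix.unitaryGroup (Fin n) ℂ) :
    IsSelfAdjoint (rectTubeTransferOperatorAniso ρ JE JM Ls) := by
  obtain ⟨C, hC⟩ := exists_rectSliceKernel_le (Ls := Ls) ρ hρ JE JM
  exact isSelfAdjoint_kernelOp (stronglyMeasurable_uncurry_rectSliceKernel ρ hρ JE JM) hC
    (rectSliceKernel_symm ρ hρu JE JM) (rectTubeTransferOperatorAniso_ae_eq hρ)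

/-- `T_{J_E,J_M}` is compact. [folklore] -/
theorem isCompactOperator_rectTubeTransferOperatorAniso (hρ : Continuous ρ) :
    IsCompactOperator (rectTubeTransferOperatorAniso ρ JE JM Ls) := by
  obtain ⟨C, hC⟩ := exists_rectSliceKernel_le (Ls := Ls) ρ hρ JE JM
  exact isCompactOperator_kernelOp hC ((norm_nonneg _).trans (hC 1 1)) (rectTubeTransferOperatorAniso_ae_eq hρ)

/-- `T_{J_E,J_M}` is positivity improving. [folklore] -/
theorem isPositivityImproving_rectTubeTransferOperatorAniso (hρ : Continuous ρ) :
    IsPositivityImproving (rectTubeTransferOperatorAniso ρ JE JM Ls) := by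
  obtain ⟨C, hC⟩ := exists_rectSliceKernel_le (Ls := Ls) ρ hρ JE JM
  exact isPositivityImproving_kernelOp (stronglyMeasurable_uncurry_rectSliceKernel ρ hρ JE JM) hC
    (rectSliceKernel_pos ρ hρ JE JM) (rectTubeTransferOperatorAniso_ae_eq hρ)

/-- `0 < ‖T_{J_E,J_M}‖`. [folklore] -/
theorem norm_rectTubeTransferOperatorAniso_pos (hρ : Continuous ρ) : 0 < ‖rectTubeTransferOperatorAniso ρ JE JM Ls‖ := by
  obtain ⟨C, hC⟩ := exists_rectSliceKernel_le (Ls := Ls) ρ hρ JE JM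
  exact norm_pos_iff.2 (kernelOp_ne_zero (stronglyMeasurable_uncurry_rectSliceKernel ρ hρ JE JM) hC
    (rectSliceKernel_pos ρ hρ JE JM) (IsProbabilityMeasure.ne_zero _) (rectTubeTransferOperatorAniso_ae_eq hρ))

/-- **The vacuum of `T_{J_E,J_M}`** (Jentzsch): a unit, a.e. strictly positive, simple top eigenvector. [cite: ReedSimonIV1978, Thm XIII.44] -/
theorem exists_rectAnisoVacuum (hρ : Continuous ρ) (hρu : ∀ g, ρ g ∈ Matrix.unitaryGroup (Fin n) ℂ) :
    ∃ Ω : Lp ℝ 2 (rectSliceMeasure G Ls), ‖Ω‖ = 1 ∧ IsStrictlyPositiveFun Ω ∧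
      rectTubeTransferOperatorAniso ρ JE JM Ls Ω = ‖rectTubeTransferOperatorAniso ρ JE JM Ls‖ • Ω ∧
      ∀ η, rectTubeTransferOperatorAniso ρ JE JM Ls η = ‖rectTubeTransferOperatorAniso ρ JE JM Ls‖ • η →
        η = (@inner ℝ _ _ Ω η) • Ω := by
  obtain ⟨Ω, h1, hpos, heig, hsimple, -⟩ :=
    (isPositivityImproving_rectTubeTransferOperatorAniso (JE := JE) (JM := JM) (Ls := Ls) hρ).exists_spectralGap
      (isSelfAdjoint_rectTubeTransferOperatorAniso hρ hρu) (isCompactOperator_rectTubeTransferOperatorAniso hρ)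
      (norm_pos_iff.1 (norm_rectTubeTransferOperatorAniso_pos hρ))
  exact ⟨Ω, h1, hpos, heig, hsimple⟩

/-- The kernel formula of `T_{J_E,J_M'}` in reweighted form relative to `T_{J_E,J_M}`. [folklore] -/
theorem rectTubeTransferOperatorAniso_ae_eq_reweighted (hρ : Continuous ρ) (JM JM' : ℝ) (φ : Lp ℝ 2 (rectSliceMeasure G Ls)) :
    (rectTubeTransferOperatorAniso ρ JE JM' Ls φ : RectSlice Ls G → ℝ) =ᵐ[rectSliceMeasure G Ls]
      fun a => ∫ b, (Real.exp ((JM' - JM) / 2 * rectMagSum ρ a) * rectSliceKernel ρ JE JM a b *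
        Real.exp ((JM' - JM) / 2 * rectMagSum ρ b)) * φ b ∂(rectSliceMeasure G Ls) := by
  refine (rectTubeTransferOperatorAniso_ae_eq hρ φ).trans (Eventually.of_forall fun a => ?_)
  refine integral_congr_ae (Eventually.of_forall fun b => ?_)
  simp only [rectSliceKernel_mag_reweight ρ JE JM Ls JM']

/-- **Lüscher positivity for every spatial coupling**: `⟪φ, T_{J_E,J_M} φ⟫ ≥ 0` for `J_E ≥ 0` and ANY real `J_M` (the isotropic
`T_{J_E,J_E} ⪰ 0` reweighted by `e^{(J_M−J_E) mag/2}`). [cite: Luscher1977] -/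
theorem inner_rectTubeTransferOperatorAniso_self_nonneg (hρ : Continuous ρ) (hρu : ∀ g, ρ g ∈ Matrix.unitaryGroup (Fin n) ℂ)
    (hJE : 0 ≤ JE) (JM : ℝ) (φ : Lp ℝ 2 (rectSliceMeasure G Ls)) :
    0 ≤ ⟪φ, rectTubeTransferOperatorAniso ρ JE JM Ls φ⟫ := by
  have hg : Continuous fun a : RectSlice Ls G => (JM - JE) / 2 * rectMagSum ρ a :=
    continuous_const.mul (continuous_rectMagSum ρ hρ)
  have hw : StronglyMeasurable fun a : RectSlice Ls G => Real.exp ((JM - JE) / 2 * rectMagSum ρ a) :=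
    (Real.continuous_exp.comp hg).stronglyMeasurable
  obtain ⟨Cw, hCw⟩ := isCompact_univ.exists_bound_of_continuousOn (Real.continuous_exp.comp hg).continuousOn
  have hT : ∀ ψ, (rectTubeTransferOperator ρ JE Ls ψ : RectSlice Ls G → ℝ) =ᵐ[rectSliceMeasure G Ls]
      fun a => ∫ b, rectSliceKernel ρ JE JE a b * ψ b ∂(rectSliceMeasure G Ls) := rectTubeTransferOperator_ae_eq JE Ls hρ
  exact inner_reweighted_self_nonneg hw (fun a => hCw a (Set.mem_univ _)) hT
    (rectTubeTransferOperatorAniso_ae_eq_reweighted (ρ := ρ) (JE := JE) hρ JE JM) (inner_rectTubeTransferOperator_self_nonneg ρ hρ hρu hJE) φ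

end Operator

/-! ### The secant sandwich in the spatial coupling -/

section Secant

variable {G : Type*} [Group G] [TopologicalSpace G] [IsTopologicalGroup G] [CompactSpace G]
  [MeasurableSpace G] [BorelSpace G] [SecondCountableTopology G] {n k : ℕ} (ρ : G →* Matrix (Fin n) (Fin n) ℂ)
  {JE : ℝ} {Ls : Fin k → ℕ} [∀ i, NeZero (Ls i)]

/-- **Lower secant bound**: `(J_M' − J_M) ∫ mag Ω² ≤ log ‖T_{J_E,J_M'}‖ − log ‖T_{J_E,J_M}‖` for every unit vacuum `Ω` of `T_{J_E,J_M}`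
(`J_E ≥ 0`, continuous unitary `ρ`; any real `J_M, J_M'`). [cite: ReedSimonIV1978, §XIII.12] [cite: Luscher1977] -/
theorem rectAniso_log_norm_sub_ge (hρ : Continuous ρ) (hρu : ∀ g, ρ g ∈ Matrix.unitaryGroup (Fin n) ℂ) (hJE : 0 ≤ JE)
    (JM JM' : ℝ) {Ω : Lp ℝ 2 (rectSliceMeasure G Ls)} (h1 : ‖Ω‖ = 1)
    (heig : rectTubeTransferOperatorAniso ρ JE JM Ls Ω = ‖rectTubeTransferOperatorAniso ρ JE JM Ls‖ • Ω) :
    (JM' - JM) * ∫ a, rectMagSum ρ a * (Ω a * Ω a) ∂(rectSliceMeasure G Ls) ≤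
      Real.log ‖rectTubeTransferOperatorAniso ρ JE JM' Ls‖ - Real.log ‖rectTubeTransferOperatorAniso ρ JE JM Ls‖ := by
  have hg : Continuous fun a : RectSlice Ls G => (JM' - JM) / 2 * rectMagSum ρ a := continuous_const.mul (continuous_rectMagSum ρ hρ)
  obtain ⟨Cg, hCg⟩ := isCompact_univ.exists_bound_of_continuousOn hg.continuousOn
  have h := log_norm_sub_log_norm_reweighted_le hg.stronglyMeasurable (fun a => hCg a (Set.mem_univ _))
    (rectTubeTransferOperatorAniso_ae_eq (ρ := ρ) (JE := JE) (JM := JM) (Ls := Ls) hρ) (rectTubeTransferOperatorAniso_ae_eq_reweighted (ρ := ρ) (JE := JE) (Ls := Ls) hρ JM JM')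
    (isSelfAdjoint_rectTubeTransferOperatorAniso hρ hρu) (inner_rectTubeTransferOperatorAniso_self_nonneg hρ hρu hJE JM)
    (norm_rectTubeTransferOperatorAniso_pos hρ) h1 heig
  have hI : ∫ a, (-2 * ((JM' - JM) / 2 * rectMagSum ρ a)) * (Ω a * Ω a) ∂(rectSliceMeasure G Ls) =
      -((JM' - JM) * ∫ a, rectMagSum ρ a * (Ω a * Ω a) ∂(rectSliceMeasure G Ls)) := by
    rw [← integral_const_mul, ← integral_neg]
    refine integral_congr_ae (Eventually.of_forall fun a => ?_); ring
  rw [hI] at h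
  linarith

/-- **Upper secant bound**: `log ‖T_{J_E,J_M'}‖ − log ‖T_{J_E,J_M}‖ ≤ (J_M' − J_M) ∫ mag Ω'²` for every unit vacuum `Ω'` of
`T_{J_E,J_M'}`. [cite: ReedSimonIV1978, §XIII.12] [cite: Luscher1977] -/
theorem rectAniso_log_norm_sub_le (hρ : Continuous ρ) (hρu : ∀ g, ρ g ∈ Matrix.unitaryGroup (Fin n) ℂ) (hJE : 0 ≤ JE)
    (JM JM' : ℝ) {Ω' : Lp ℝ 2 (rectSliceMeasure G Ls)} (h1 : ‖Ω'‖ = 1)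
    (heig : rectTubeTransferOperatorAniso ρ JE JM' Ls Ω' = ‖rectTubeTransferOperatorAniso ρ JE JM' Ls‖ • Ω') :
    Real.log ‖rectTubeTransferOperatorAniso ρ JE JM' Ls‖ - Real.log ‖rectTubeTransferOperatorAniso ρ JE JM Ls‖ ≤
      (JM' - JM) * ∫ a, rectMagSum ρ a * (Ω' a * Ω' a) ∂(rectSliceMeasure G Ls) := by
  have h := rectAniso_log_norm_sub_ge ρ (Ls := Ls) hρ hρu hJE JM' JM h1 heig
  linarith

end Secant

/-! ### The cell's `SU(2)` reading: the magnetic secant leg of the plaquette rows -/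

section SU2

variable {k : ℕ}

/-- **The cell's two-coupling tube operator**: `SU(2)`, fundamental, temporal Wilson coupling `β_t` and spatial `β_s` (`J = β/2`). -/
theorem su2_rectAniso_secant_ge {βt : ℝ} (hβt : 0 ≤ βt) (βs h : ℝ) (Ls : Fin k → ℕ) [∀ i, NeZero (Ls i)]
    {Ω : Lp ℝ 2 (rectSliceMeasure (Matrix.specialUnitaryGroup (Fin 2) ℂ) Ls)} (h1 : ‖Ω‖ = 1)
    (heig : rectTubeTransferOperatorAniso (fundamentalRep (Fin 2)) (βt / 2) (βs / 2) Ls Ω =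
      ‖rectTubeTransferOperatorAniso (fundamentalRep (Fin 2)) (βt / 2) (βs / 2) Ls‖ • Ω) :
    h * ∫ a, (rectMagSum (fundamentalRep (Fin 2)) a / 2) * (Ω a * Ω a)
        ∂(rectSliceMeasure (Matrix.specialUnitaryGroup (Fin 2) ℂ) Ls) ≤
      Real.log ‖rectTubeTransferOperatorAniso (fundamentalRep (Fin 2)) (βt / 2) ((βs + h) / 2) Ls‖ -
        Real.log ‖rectTubeTransferOperatorAniso (fundamentalRep (Fin 2)) (βt / 2) (βs / 2) Ls‖ := by
  haveI : SecondCountableTopology (Matrix.specialUnitaryGroup (Fin 2) ℂ) :=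
    Literature.MathematicalPhysics.QuantumLattice.secondCountableTopology_su2
  have hh := rectAniso_log_norm_sub_ge (fundamentalRep (Fin 2)) (Ls := Ls) (continuous_fundamentalRep (Fin 2))
    fundamentalRep_mem_unitaryGroup (by positivity : 0 ≤ βt / 2) (βs / 2) ((βs + h) / 2) h1 heig
  have hI : h * ∫ a, (rectMagSum (fundamentalRep (Fin 2)) a / 2) * (Ω a * Ω a)
      ∂(rectSliceMeasure (Matrix.specialUnitaryGroup (Fin 2) ℂ) Ls) =
      ((βs + h) / 2 - βs / 2) * ∫ a, rectMagSum (fundamentalRep (Fin 2)) a * (Ω a * Ω a)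
        ∂(rectSliceMeasure (Matrix.specialUnitaryGroup (Fin 2) ℂ) Ls) := by
    rw [← integral_const_mul, ← integral_const_mul]
    refine integral_congr_ae (Eventually.of_forall fun a => ?_); ring
  rw [hI]; exact hh

/-- **The magnetic SECANT LEG as a theorem**: `ln λ₀(β_t, β_s + h) − ln λ₀(β_t, β_s) ≤ h ∫ (mag/2) Ω_h²` with `Ω_h` the vacuum at
`β_s + h` (`mag/2 = Σ_p ½·Re tr U_p`); together with `su2_rectAniso_secant_ge` every magnetic chord slope lies between the vacuum
plaquette sums at its ends.  Finite volume only. [cite: ReedSimonIV1978, §XIII.12] -/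
theorem su2_rectAniso_secant_le {βt : ℝ} (hβt : 0 ≤ βt) (βs h : ℝ) (Ls : Fin k → ℕ) [∀ i, NeZero (Ls i)]
    {Ω' : Lp ℝ 2 (rectSliceMeasure (Matrix.specialUnitaryGroup (Fin 2) ℂ) Ls)} (h1 : ‖Ω'‖ = 1)
    (heig : rectTubeTransferOperatorAniso (fundamentalRep (Fin 2)) (βt / 2) ((βs + h) / 2) Ls Ω' =
      ‖rectTubeTransferOperatorAniso (fundamentalRep (Fin 2)) (βt / 2) ((βs + h) / 2) Ls‖ • Ω') :
    Real.log ‖rectTubeTransferOperatorAniso (fundamentalRep (Fin 2)) (βt / 2) ((βs + h) / 2) Ls‖ -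
        Real.log ‖rectTubeTransferOperatorAniso (fundamentalRep (Fin 2)) (βt / 2) (βs / 2) Ls‖ ≤
      h * ∫ a, (rectMagSum (fundamentalRep (Fin 2)) a / 2) * (Ω' a * Ω' a)
        ∂(rectSliceMeasure (Matrix.specialUnitaryGroup (Fin 2) ℂ) Ls) := by
  haveI : SecondCountableTopology (Matrix.specialUnitaryGroup (Fin 2) ℂ) :=
    Literature.MathematicalPhysics.QuantumLattice.secondCountableTopology_su2
  have hh := rectAniso_log_norm_sub_le (fundamentalRep (Fin 2)) (Ls := Ls) (continuous_fundamentalRep (Fin 2))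
    fundamentalRep_mem_unitaryGroup (by positivity : 0 ≤ βt / 2) (βs / 2) ((βs + h) / 2) h1 heig
  have hI : h * ∫ a, (rectMagSum (fundamentalRep (Fin 2)) a / 2) * (Ω' a * Ω' a)
      ∂(rectSliceMeasure (Matrix.specialUnitaryGroup (Fin 2) ℂ) Ls) =
      ((βs + h) / 2 - βs / 2) * ∫ a, rectMagSum (fundamentalRep (Fin 2)) a * (Ω' a * Ω' a)
        ∂(rectSliceMeasure (Matrix.specialUnitaryGroup (Fin 2) ℂ) Ls) := by
    rw [← integral_const_mul, ← integral_const_mul]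
    refine integral_congr_ae (Eventually.of_forall fun a => ?_); ring
  rw [hI]; exact hh

end SU2

end Summit.Ventures.YMGap.FlowData
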